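import Literature.NumberTheory.ComplexMultiplication.CMLatticeRingClassTowerProductOverClassGroup
import Literature.NumberTheory.ComplexMultiplication.CMLatticeRingClassTowerNoncyclicStructure
import Literature.NumberTheory.ComplexMultiplication.CMLatticeRingClassTowerExponent
import HarnessLib

/-!
# The EXPONENT of `Gal(K_n/K_1) ≃ (𝒪_K/n𝒪_K)^×/(ℤ/nℤ)^×` at every level `n` (ideal-theoretic side, `𝒪_K^× = {±1}`):
# `exp G(n) = lcm_p exp G(p^{v_p(n)})`, and `exp G(p^k) = #G(p^k)` or `#G(p^k)/p` according as `G(p^k)` is cyclic or not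

Family `hodge`, lane `lit-hodgefound` (Track 2 foundations library; Layer A3 at `g = 1`, the «arbitrary
order» series), topic `Literature/NumberTheory/ComplexMultiplication`, namespace
`Literature.NumberTheory.ComplexMultiplication.CMTypeLattice` — assembling `CMLatticeRingClassTowerProductOverClassGroup`
(§7, the CRT form `G(n) ≃* ∏_p G(p^{v_p(n)})`, `d_K < −4`), the classification of the `p`-power towers over
`Cl(𝒪_K)` (`…Classification`, `…TwoClassification`), the explicit non-cyclic structures (`…NoncyclicStructure`:
`C_{2^{k−1}} × C_2`, `C_{2^{k−2}} × C_2 × G(2)`) and `…Exponent` (`exp = 3^{k−1}` for the non-cyclic `3`-towers) into the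
exponent of `G(n) = ker(I_K(n)/P_{K,ℤ}(n) → Cl(𝒪_K))` for every `n`. THEOREMS ONLY: no definition, no named fact
(D-0026; net Literature debt 0).

## Sources, VERBATIM

* B. H. Gross, *Kolyvagin's work on modular elliptic curves* [GrossLMS1991], §1 («`D ≠ 3, 4`, so … `𝒪^× = ⟨±1⟩`»),
  §3 («`G_n ≃ ∏ G_ℓ` … The subgroups `G_ℓ ≃ F_λ^×/F_ℓ^×` are cyclic of order `ℓ+1`»; field diagram
  `Gal(K_n/K_1) ≃ (𝒪_K/n𝒪_K)^×/(ℤ/nℤ)^×`).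
* D. A. Cox, *Primes of the Form x² + ny²* [Cox2013], §7.D Thm. 7.24, (7.27), Cor. 7.28, pp. 146–148 (the orders
  `#G(p^k) = p^{k−1}(p − (d_K/p))`).
* J.-P. Serre, *A Course in Arithmetic* [Serre1973], Ch. II §3.2 Prop. 8, p. 17: «`U_1/U_n` is of order `p^{n−1}`;
  hence it is a cyclic group», «If `p = 2`, `U_1 = {±1} × U_2` and `U_2` is isomorphic to `ℤ_2`».
* J. Neukirch, *Algebraic Number Theory* [NeukirchANT1999], Ch. II (5.7) Proposition, p. 140: «The torsion subgroup
  of `U^{(1)}` is the group `μ_{p^a}`» (the second cyclic factor `C_p` of the non-cyclic towers).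
* K. Martin, *Rationality fields of CM modular forms* [Martin2025RationalityFieldsCM], §8 (after Ranum 1910): the
  dyadic structures `(𝔬_E/2^n)^× ≃ C_2 × C_{2^{n−2}}` (split), `C_3 × ⟨−1⟩ × C_{2^{n−1}} × C_{2^{n−2}}` (inert), … —
  through the tree's `CMLatticeRingClassTowerNoncyclicStructure`.
* J. Gallian, *Contemporary Abstract Algebra* [Gallian2025], Ch. 8 Thm. 8.2 (proof): «`|(g, h)| = lcm(m, n)`» — the
  exponent of a product is the `lcm` (Mathlib's `Monoid.exponent_prod` / `Monoid.exponent_pi`).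

## What is formalised (theorems only; ideal-theoretic side, `d_K < −4`)

`K` imaginary quadratic (`[IsCMField K]`, `finrank ℚ K = 2`, `d_K < −4`), `G(n) := ker(toClassGroup K n)`, `v_p = v_p(n)`.

* §1 **`exponent_ker_toClassGroup_eq_lcm_primePow`** — `exp G(n) = lcm_{p ∣ n} exp G(p^{v_p})`.
* §2 `exponent_ker_toClassGroup_primePow_of_isCyclic` (`exp G(p^k) = p^{k−1}(p − (d_K/p))` when `G(p^k)` is cyclic);
  **`exponent_ker_toClassGroup_primePow_mul_of_not_isCyclic`** (`exp G(p^k) · p = #G(p^k)` when it is not — the three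
  families `p = 3, k ≥ 2, d_K ≡ 6 (9)` / `p = 2, k ≥ 2, d_K ≡ 12 (16)` / `p = 2, k ≥ 3, d_K odd`);
  **`exponent_ker_toClassGroup_primePow`** (uniformly: `exp G(p^k) = #G(p^k)` if cyclic, else `#G(p^k)/p`).
* §3 **`exponent_ker_toClassGroup_eq_finsetLcm`** — `exp G(n) = lcm_{p ∣ n} e_p`, `e_p` as in §2;
  `exponent_ker_toClassGroup_eq_natCard_iff` (`exp G(n) = #G(n)` iff `G(n)` cyclic).

NOT here: `K = ℚ(i)`, `ℚ(√−3)` over `K_1`; layers `m ≥ 2`; the Galois side (Layer B).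

## References
* [GrossLMS1991] B. H. Gross, in *L-functions and Arithmetic* (Durham 1989), LMS LNS 153, CUP 1991, §1, §3.
  [cite: GrossLMS1991, §1 (D ≠ 3, 4) and §3 («G_n ≃ ∏ G_ℓ», «cyclic of order ℓ+1»)]
* [Cox2013] D. A. Cox, *Primes of the Form x² + ny²*, 2nd ed., §7.D Thm. 7.24, (7.27), Cor. 7.28, pp. 146–148.
  [cite: Cox2013, §7.D Thm. 7.24, (7.27), Cor. 7.28, pp. 146–148]
* [Serre1973] Ch. II §3.2 Prop. 8, p. 17. [cite: Serre1973, Ch. II §3.2 Prop. 8, p. 17]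
* [NeukirchANT1999] Ch. II (5.7) Proposition, p. 140. [cite: NeukirchANT1999, Ch. II (5.7) Proposition, p. 140]
* [Martin2025RationalityFieldsCM] §8. [cite: Martin2025RationalityFieldsCM, §8]
* [Gallian2025] Ch. 8 Thm. 8.2. [cite: Gallian2025, Ch. 8 Thm. 8.2]

## Mathlib / tree search
Tree, BY NAME: `nonempty_mulEquiv_ker_toClassGroup_pi_primePow`, `natCard_ker_toClassGroup_eq_prod` (`…ProductOverClassGroup`),
`nonempty_mulEquiv_ker_toClassGroup_two_pow`, `nonempty_mulEquiv_ker_toClassGroup_two_pow_of_odd` (`…NoncyclicStructure`),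
`exponent_ker_toClassGroup_three_pow` (`…Exponent`), `natCard_ker_toClassGroup_three_pow` (`…RamifiedThree`),
`isCyclic_ker_toClassGroup_two_pow_iff_of_one_le`, `isCyclic_ker_toClassGroup_two`, `natCard_ker_toClassGroup_two_of_odd`
(`…TwoClassification`), `not_isCyclic_ker_toClassGroup_prime_pow_iff`, `isCyclic_ker_toClassGroup_of_odd_prime`
(`…Classification`), `discr_emod_sixteen_of_even` (`…TwoOverClassGroup`), `finite_ringClassGroup`. Mathlib:
`Monoid.exponent_eq_of_mulEquiv`, `Monoid.exponent_pi`, `Monoid.exponent_prod`, `Monoid.exponent_multiplicative`,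
`ZMod.exponent`, `IsCyclic.exponent_eq_card`, `IsCyclic.iff_exponent_eq_card`, `Nat.card_prod`, `Nat.card_zmod`,
`lcm_eq_nat_lcm`, `Nat.lcm_eq_right_iff_dvd`, `Nat.Coprime.lcm_eq_mul`, `Nat.coprime_pow_left_iff`. The tree's
`exponent_ker_toClassGroup_eq_lcm` (`…ProductOverClassGroup` §5) is the all-inert square-free case (`lcm(ℓ + 1)`);
grep «exponent_ker_toClassGroup_eq_lcm_primePow∣exponent_ker_toClassGroup_primePow∣ExponentEveryLevel»: none.
-/

open scoped NumberField nonZeroDivisors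
open NumberField Module

namespace Literature.NumberTheory.ComplexMultiplication

open Literature.NumberTheory.QuadraticFields Literature.NumberTheory.QuadraticFields.RingClass
open Literature.NumberTheory.QuadraticFields.Quadratic
open Literature.NumberTheory.EllipticCurves (IsImaginaryQuadratic isImaginaryQuadratic_iff_isCMField)

namespace CMTypeLattice

variable {K : Type} [Field K] [NumberField K] [IsCMField K] (h2 : finrank ℚ K = 2)

/-! ## §1. `exp G(n) = lcm_p exp G(p^{v_p(n)})` over `K_1` (`d_K < −4`) -/

include h2 in
/-- **THE EXPONENT OF `Gal(K_n/K_1)` IS THE `lcm` OF THE EXPONENTS OF THE `p`-PRIMARY LEVELS** (`d_K < −4`, every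
`n ≥ 1`): `exp ker(I_K(n)/P_{K,ℤ}(n) → Cl(𝒪_K)) = lcm_{p ∣ n} exp ker(I_K(p^{v_p(n)})/P_{K,ℤ}(p^{v_p(n)}) → Cl(𝒪_K))` —
the CRT form `G(n) ≃* ∏_p G(p^{v_p(n)})` (`Gal(K_n/K_1) ≅ ∏_p Gal(K_{p^{v_p}}/K_1)`) and `exp ∏ = lcm exp`.
[cite: GrossLMS1991, §1 (D ≠ 3, 4) and §3 («G_n ≃ ∏ G_ℓ»)] [cite: Cox2013, §7.D Thm. 7.24, (7.27), pp. 146–148] -/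
theorem exponent_ker_toClassGroup_eq_lcm_primePow (hd4 : NumberField.discr K < -4) {n : ℕ} (hn : n ≠ 0) :
    Monoid.exponent (toClassGroup K n).ker =
      Finset.univ.lcm (fun p : n.primeFactors =>
        Monoid.exponent (toClassGroup K ((p : ℕ) ^ n.factorization p)).ker) := by
  obtain ⟨e⟩ := nonempty_mulEquiv_ker_toClassGroup_pi_primePow h2 hd4 hn
  rw [Monoid.exponent_eq_of_mulEquiv e, Monoid.exponent_pi]

/-! ## §2. The exponent of a `p`-primary level `G(p^k)`: `#G(p^k)` if cyclic, `#G(p^k)/p` if not -/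

include h2 in
/-- **Cyclic `p`-primary levels: `exp G(p^k) = #G(p^k) = p^{k−1}(p − (d_K/p))`** (`d_K < −4`; e.g. every odd `p ∤ d_K`,
every `p ≥ 5`, `p = 2` with `d_K ≡ 8 (16)`; Serre's cyclic `U_1/U_n`). [cite: Cox2013, §7.D Thm. 7.24, pp. 146–148]
[cite: Serre1973, Ch. II §3.2 Prop. 8, p. 17] [cite: GrossLMS1991, §3 («cyclic of order ℓ+1»)] -/
theorem exponent_ker_toClassGroup_primePow_of_isCyclic (hd4 : NumberField.discr K < -4) {p k : ℕ} (hp : p.Prime)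
    (hk : k ≠ 0) (hc : IsCyclic (toClassGroup K (p ^ k)).ker) :
    (Monoid.exponent (toClassGroup K (p ^ k)).ker : ℤ) =
      (p : ℤ) ^ (k - 1) * ((p : ℤ) - (if p = 2 then (if NumberField.discr K % 8 = 1 then 1
        else if NumberField.discr K % 8 = 5 then -1 else 0) else jacobiSym (NumberField.discr K) p)) := by
  haveI := hc
  rw [IsCyclic.exponent_eq_card, natCard_ker_toClassGroup_eq_prod h2 hd4 (pow_ne_zero k hp.ne_zero),
    Nat.primeFactors_prime_pow hk hp, Finset.prod_singleton, Nat.Prime.factorization_pow hp, Finsupp.single_eq_same]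

include h2 in
/-- **Non-cyclic `p`-primary levels: `exp G(p^k) · p = #G(p^k)`** (`d_K < −4`). By the tree's classification the
non-cyclic `G(p^k) = ker(I_K(p^k)/P_{K,ℤ}(p^k) → Cl(𝒪_K))` are exactly: `p = 3`, `k ≥ 2`, `d_K ≡ 6 (9)`
(`≅ C_{3^{k−1}} × C_3`, exponent `3^{k−1}`, order `3^k`); `p = 2`, `k ≥ 2`, `d_K ≡ 12 (16)` (`≅ C_{2^{k−1}} × C_2`);
`p = 2`, `k ≥ 3`, `d_K` odd (`≅ C_{2^{k−2}} × C_2 × G(2)`, `#G(2) ∈ {1, 3}`) — in each case the second cyclic factor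
(Neukirch's torsion `μ_p` of `U^{(1)}` modulo global units, resp. Martin–Ranum's dyadic `C_2`) costs exactly one
factor `p` in the exponent. [cite: NeukirchANT1999, Ch. II (5.7) Proposition, p. 140] [cite: Serre1973, Ch. II §3.2 Prop. 8, p. 17]
[cite: Martin2025RationalityFieldsCM, §8 (dyadic modular quotients; after Ranum 1910)] [cite: Cox2013, §7.D Thm. 7.24, pp. 146–148] -/
theorem exponent_ker_toClassGroup_primePow_mul_of_not_isCyclic (hd4 : NumberField.discr K < -4) {p k : ℕ}
    (hp : p.Prime) (hk : k ≠ 0) (hnc : ¬ IsCyclic (toClassGroup K (p ^ k)).ker) :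
    Monoid.exponent (toClassGroup K (p ^ k)).ker * p = Nat.card (toClassGroup K (p ^ k)).ker := by
  have hd3 : NumberField.discr K ≠ -3 := by omega
  have hd4' : NumberField.discr K ≠ -4 := by omega
  have hk1 : 1 ≤ k := Nat.one_le_iff_ne_zero.2 hk
  -- transport along `p ^ 1 = p`
  have key : ∀ {N N' : ℕ} (_ : N = N'),
      (IsCyclic (toClassGroup K N).ker ↔ IsCyclic (toClassGroup K N').ker) := by
    intro N N' h; subst h; exact Iff.rfl
  by_cases hp2 : p = 2
  · subst hp2
    have hcyc := isCyclic_ker_toClassGroup_two_pow_iff_of_one_le h2 hk1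
    have hk2 : 2 ≤ k := by
      by_contra h
      exact hnc (hcyc.2 (Or.inl (by omega)))
    have h8 : NumberField.discr K % 16 ≠ 8 := fun h => hnc (hcyc.2 (Or.inr (Or.inr (Or.inr h))))
    rcases Int.even_or_odd (NumberField.discr K) with heven | hodd
    · -- `d_K` even, not `≡ 8 (16)`: `d_K ≡ 12 (16)`, `G(2^k) ≅ C_{2^{k−1}} × C_2`
      have h12 : NumberField.discr K % 16 = 12 := (discr_emod_sixteen_of_even h2 heven).resolve_left h8
      obtain ⟨e⟩ := nonempty_mulEquiv_ker_toClassGroup_two_pow h2 h12 hd4' hk2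
      rw [Monoid.exponent_eq_of_mulEquiv e, Nat.card_congr e.toEquiv, Monoid.exponent_prod,
        Monoid.exponent_multiplicative, Monoid.exponent_multiplicative, ZMod.exponent, ZMod.exponent,
        Nat.card_prod, Nat.card_congr Multiplicative.toAdd, Nat.card_congr Multiplicative.toAdd, Nat.card_zmod,
        Nat.card_zmod, lcm_eq_nat_lcm]
      have hdvd : 2 ∣ 2 ^ (k - 1) := dvd_pow_self 2 (by omega)
      rw [Nat.lcm_comm, (Nat.lcm_eq_right_iff_dvd).2 hdvd]
    · -- `d_K` odd: `k ≥ 3` and `G(2^k) ≅ C_{2^{k−2}} × C_2 × G(2)` with `#G(2) ∈ {1, 3}`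
      have hk3 : 3 ≤ k := by
        by_contra h
        have hk2' : k = 2 := by omega
        refine hnc (hcyc.2 (Or.inr (Or.inl ⟨hk2', fun ⟨h12, _⟩ => ?_⟩)))
        have := Int.odd_iff.1 hodd
        omega
      obtain ⟨e⟩ := nonempty_mulEquiv_ker_toClassGroup_two_pow_of_odd h2 hodd hk3
      haveI := finite_ringClassGroup (K := K) h2 two_ne_zero
      haveI := isCyclic_ker_toClassGroup_two h2 (K := K)
      have hG2 : Monoid.exponent (toClassGroup K 2).ker = Nat.card (toClassGroup K 2).ker :=
        IsCyclic.exponent_eq_card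
      rw [Monoid.exponent_eq_of_mulEquiv e, Nat.card_congr e.toEquiv, Monoid.exponent_prod, Monoid.exponent_prod,
        Monoid.exponent_multiplicative, Monoid.exponent_multiplicative, ZMod.exponent, ZMod.exponent,
        Nat.card_prod, Nat.card_prod, Nat.card_congr Multiplicative.toAdd, Nat.card_congr Multiplicative.toAdd,
        Nat.card_zmod, Nat.card_zmod, hG2, lcm_eq_nat_lcm, lcm_eq_nat_lcm]
      have hdvd : 2 ∣ 2 ^ (k - 2) := dvd_pow_self 2 (by omega)
      rw [Nat.lcm_comm (2 ^ (k - 2)) 2, (Nat.lcm_eq_right_iff_dvd).2 hdvd]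
      -- `lcm (2^{k−2}) #G(2) = 2^{k−2} · #G(2)` as `#G(2) ∈ {1, 3}` is odd
      rcases natCard_ker_toClassGroup_two_of_odd h2 hodd with h1 | h3
      · rw [h1, Nat.lcm_one_right]; ring
      · rw [h3, Nat.Coprime.lcm_eq_mul ((Nat.coprime_pow_left_iff (by omega) _ _).2 (by norm_num))]
        ring
  · -- odd `p`: `k ≥ 2` and `p = 3`, `d_K ≡ 6 (9)`
    have hk2 : 2 ≤ k := by
      by_contra h
      have hk1' : k = 1 := by omega
      exact hnc ((key (by rw [hk1', pow_one])).1 (isCyclic_ker_toClassGroup_of_odd_prime h2 hp hp2))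
    obtain ⟨hp3, hd9, -⟩ := (not_isCyclic_ker_toClassGroup_prime_pow_iff h2 hp hp2 hk2).1 hnc
    subst hp3
    have h3dvd : (3 : ℤ) ∣ NumberField.discr K := by omega
    rw [exponent_ker_toClassGroup_three_pow h2 hd4 hd9 hk2, natCard_ker_toClassGroup_three_pow h2 hd4 h3dvd hk1,
      ← pow_succ]
    congr 1
    omega

include h2 in
open Classical in
/-- **THE EXPONENT OF A `p`-PRIMARY LEVEL, UNIFORMLY** (`d_K < −4`, `p` prime, `k ≥ 1`):
`exp G(p^k) = #G(p^k)` if `G(p^k)` is cyclic and `= #G(p^k)/p` otherwise (`#G(p^k) = p^{k−1}(p − (d_K/p))`, THEOREM 7.24).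
[cite: Cox2013, §7.D Thm. 7.24, pp. 146–148] [cite: NeukirchANT1999, Ch. II (5.7) Proposition, p. 140]
[cite: Serre1973, Ch. II §3.2 Prop. 8, p. 17] -/
theorem exponent_ker_toClassGroup_primePow (hd4 : NumberField.discr K < -4) {p k : ℕ} (hp : p.Prime) (hk : k ≠ 0) :
    Monoid.exponent (toClassGroup K (p ^ k)).ker =
      if IsCyclic (toClassGroup K (p ^ k)).ker then Nat.card (toClassGroup K (p ^ k)).ker
      else Nat.card (toClassGroup K (p ^ k)).ker / p := by
  split_ifs with hc
  · haveI := hc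
    exact IsCyclic.exponent_eq_card
  · rw [← exponent_ker_toClassGroup_primePow_mul_of_not_isCyclic h2 hd4 hp hk hc, Nat.mul_div_cancel _ hp.pos]

/-! ## §3. `exp G(n)` for every `n`, and `exp G(n) = #G(n)` iff `G(n)` is cyclic -/

include h2 in
open Classical in
/-- **THE EXPONENT OF `Gal(K_n/K_1) ≃ (𝒪_K/n𝒪_K)^×/(ℤ/nℤ)^×` AT EVERY LEVEL** (ideal-theoretic side, `d_K < −4`, `n ≥ 1`):
`exp ker(I_K(n)/P_{K,ℤ}(n) → Cl(𝒪_K)) = lcm_{p ∣ n} e_p` with `e_p = #G(p^{v_p})` (`= p^{v_p−1}(p − (d_K/p))`) when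
`G(p^{v_p})` is cyclic and `e_p = #G(p^{v_p})/p` in the three non-cyclic families (`p = 3`, `9 ∣ n`, `d_K ≡ 6 (9)`;
`p = 2`, `4 ∣ n`, `d_K ≡ 12 (16)`; `p = 2`, `8 ∣ n`, `d_K` odd). [cite: GrossLMS1991, §1 (D ≠ 3, 4) and §3 («G_n ≃ ∏ G_ℓ»)]
[cite: Cox2013, §7.D Thm. 7.24, (7.27), pp. 146–148] [cite: NeukirchANT1999, Ch. II (5.7) Proposition, p. 140] -/
theorem exponent_ker_toClassGroup_eq_finsetLcm (hd4 : NumberField.discr K < -4) {n : ℕ} (hn : n ≠ 0) :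
    Monoid.exponent (toClassGroup K n).ker =
      Finset.univ.lcm (fun p : n.primeFactors =>
        if IsCyclic (toClassGroup K ((p : ℕ) ^ n.factorization p)).ker
        then Nat.card (toClassGroup K ((p : ℕ) ^ n.factorization p)).ker
        else Nat.card (toClassGroup K ((p : ℕ) ^ n.factorization p)).ker / p) := by
  rw [exponent_ker_toClassGroup_eq_lcm_primePow h2 hd4 hn]
  exact Finset.lcm_congr rfl fun p _ => exponent_ker_toClassGroup_primePow h2 hd4
    (Nat.prime_of_mem_primeFactors p.2)
    ((Nat.prime_of_mem_primeFactors p.2).factorization_pos_of_dvd hn (Nat.dvd_of_mem_primeFactors p.2)).ne'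

omit [IsCMField K] in
include h2 in
/-- **`exp G(n) ∣ #G(n)`, with equality iff `G(n)` is cyclic** (`G(n)` is finite abelian): the exponent detects
cyclicity of `Gal(K_n/K_1)` — compare `CMLatticeRingClassTowerCyclicityCriterion`. [cite: Gallian2025, Ch. 8 Thm. 8.2 (proof: |(g, h)| = lcm(m, n))]
[cite: Cox2013, §7.D Thm. 7.24] -/
theorem exponent_ker_toClassGroup_eq_natCard_iff {n : ℕ} (hn : n ≠ 0) :
    Monoid.exponent (toClassGroup K n).ker = Nat.card (toClassGroup K n).ker ↔ IsCyclic (toClassGroup K n).ker := by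
  haveI := finite_ringClassGroup (K := K) h2 hn
  exact (IsCyclic.iff_exponent_eq_card (α := (toClassGroup K n).ker)).symm

end CMTypeLattice

end Literature.NumberTheory.ComplexMultiplication
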